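import Summits.ValiantsHypothesis.ValiantsHypothesis.Theorems.FifoMatchingArcCoeff
import HarnessLib

/-!
# Arc sets of involutions cover every position exactly once (support for `TimeCutFoolingSet`)

Helper toward route item `stmt-ValiantsHypothesis-11621` (`Theses.FifoMatching.TimeCutFoolingSet`),
the "off-diagonal" half of the fooling-set argument: the arc set of a fixed-point-free involution
covers every position (`exists_mem_arcs`) and two distinct arcs share no endpoint
(`arcs_endpoint_disjoint`); hence a set of arcs in which some position is an endpoint of two distinct
arcs is the arc set of no involution (`no_involution_of_shared_endpoint`), so its indicator monomial
has coefficient `0` in any matching sum (with `coeff_arcIndicator_sum_matchings`). [folklore]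
-/

noncomputable section

-- layout Summits/ValiantsHypothesis/ValiantsHypothesis forces the duplicated namespace component
set_option linter.dupNamespace false

namespace Summit.ValiantsHypothesis.ValiantsHypothesis.Theorems.FifoMatching

variable {N : ℕ}

/-- Every position is an endpoint of some arc of a fixed-point-free involution. [folklore] -/
theorem exists_mem_arcs {M : Fin N → Fin N} (hM : ∀ i, M (M i) = i) (hM0 : ∀ i, M i ≠ i)
    (x : Fin N) : ∃ e ∈ arcs M, e.1 = x ∨ e.2 = x := by
  rcases lt_or_gt_of_ne (hM0 x).symm with hx | hx
  · exact ⟨(x, M x), mem_arcs.mpr ⟨hx, rfl⟩, Or.inl rfl⟩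
  · refine ⟨(M x, x), mem_arcs.mpr ⟨?_, ?_⟩, Or.inr rfl⟩
    · show M x < M (M x)
      rw [hM]; exact hx
    · show x = M (M x)
      rw [hM]

/-- **Two distinct arcs of an involution share no endpoint.** [folklore] -/
theorem arcs_endpoint_disjoint {M : Fin N → Fin N} (hM : ∀ i, M (M i) = i) {e e' : Fin N × Fin N}
    (he : e ∈ arcs M) (he' : e' ∈ arcs M) (hne : e ≠ e') :
    e.1 ≠ e'.1 ∧ e.1 ≠ e'.2 ∧ e.2 ≠ e'.1 ∧ e.2 ≠ e'.2 := by
  obtain ⟨h1, h2⟩ := mem_arcs.mp he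
  obtain ⟨h1', h2'⟩ := mem_arcs.mp he'
  have hab : e.1 ≠ e'.1 := fun h => hne (Prod.ext h (by rw [h2, h2', h]))
  refine ⟨hab, fun h => ?_, fun h => ?_, fun h => ?_⟩
  · -- `e.1 = e'.2 = M e'.1` forces `M e.1 = e'.1`, and the two arcs point in opposite directions
    have hMa : M e.1 = e'.1 := by rw [h, h2', hM]
    have h3 : e'.1 < e.1 := by rw [h, h2']; exact h1'
    rw [hMa] at h1
    exact lt_asymm h1 h3
  · have hMb : M e'.1 = e.1 := by rw [← h, h2, hM]
    have h3 : e.1 < e'.1 := by rw [← h, h2]; exact h1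
    rw [hMb] at h1'
    exact lt_asymm h1' h3
  · apply hab
    have : M (M e.1) = M (M e'.1) := by rw [← h2, ← h2', h]
    rwa [hM, hM] at this

/-- **A set of arcs with a shared endpoint is the arc set of no involution.** [folklore] -/
theorem no_involution_of_shared_endpoint {F : Finset (Fin N × Fin N)} {e e' : Fin N × Fin N}
    (he : e ∈ F) (he' : e' ∈ F) (hne : e ≠ e') {x : Fin N} (hx : e.1 = x ∨ e.2 = x)
    (hx' : e'.1 = x ∨ e'.2 = x) {M : Fin N → Fin N} (hM : ∀ i, M (M i) = i) (hF : arcs M = F) :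
    False := by
  rw [← hF] at he he'
  obtain ⟨d1, d2, d3, d4⟩ := arcs_endpoint_disjoint hM he he' hne
  rcases hx with hx | hx <;> rcases hx' with hx' | hx'
  · exact d1 (hx.trans hx'.symm)
  · exact d2 (hx.trans hx'.symm)
  · exact d3 (hx.trans hx'.symm)
  · exact d4 (hx.trans hx'.symm)

open scoped Classical in
/-- **Off-diagonal entries of the fooling matrix vanish:** if some position is an endpoint of two
distinct arcs of `F`, the indicator monomial of `F` has coefficient `0` in every matching sum over
involutions. [folklore] -/
theorem coeff_arcIndicator_eq_zero_of_shared_endpoint {R : Type*} [CommSemiring R]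
    (P : (Fin N → Fin N) → Prop) (hP : ∀ M, P M → (∀ i, M (M i) = i) ∧ ∀ i, M i ≠ i)
    {F : Finset (Fin N × Fin N)} {e e' : Fin N × Fin N} (he : e ∈ F) (he' : e' ∈ F) (hne : e ≠ e')
    {x : Fin N} (hx : e.1 = x ∨ e.2 = x) (hx' : e'.1 = x ∨ e'.2 = x) :
    MvPolynomial.coeff (arcIndicator F) (∑ M : Fin N → Fin N,
      if P M then ∏ i : Fin N, (if i < M i then MvPolynomial.X (i, M i) else 1)
      else (0 : MvPolynomial (Fin N × Fin N) R)) = 0 := by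
  rw [coeff_arcIndicator_sum_matchings P hP F, if_neg]
  rintro ⟨M, hPM, hF⟩
  exact no_involution_of_shared_endpoint he he' hne hx hx' (hP M hPM).1 hF

end Summit.ValiantsHypothesis.ValiantsHypothesis.Theorems.FifoMatching

end
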